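import Mathlib
import HarnessLib
import Summits.Ventures.LatticeQCDFlow.Exactness.SU2WilsonFlowLOMemberFTHMCN
import Summits.Ventures.LatticeQCDFlow.Exactness.SU2ResidualExactForceRegular
import Summits.Ventures.LatticeQCDFlow.Exactness.SU2LeapfrogHMCWilson

/-!
# FT-HMC through a LEARNED residual `SU(2)` member WITH THE EXACT AUTODIFF FORCE AS RUN, at every `nstep` below a trajectory-length threshold, converges to the Wilson measure from every start — any torus, any schedule, any smooth conditioner under the uniform refusal bound

HONEST FRAMING: exact (Metropolis-corrected) sampling algorithms for lattice gauge theory;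
figures of merit are autocorrelation/cost numbers at stated couplings and volumes; no
continuum-physics claim.

Venture `LatticeQCDFlow` (cell pub-lqcd), topic `Exactness`; FANOUT row 14 (`eng-flowhmc`, member
`maps.residual_trained_scan` inside row 9's multi-step kernel `su2LeapfrogHMCN`).  NEW WORK of the cell —
the learned twin of `SU2WilsonFlowLOExactForceFTHMCN`: `SU2WilsonFlowLOMemberFTHMCN.su2MaskedKickSchedule_package`
(instantiated here for the residual data: `su2Residual_member_package`), `SU2ResidualExactForceRegular`
(the exact force through the learned member is measurable, bounded, Lipschitz), `SUNMultiStepLeapfrogFTHMCErgodic`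
(trajectory-length form), `SU2LeapfrogHMCWilson` (`β S_W` bounded, `su2GibbsLaw = wilsonMeasure`),
`SU2ResidualLayer` (`measurable_residualJ`, `residualJ_local`, `norm_residualJ_le`); nothing is cited as
a fact; no number.

* **`su2Residual_member_package`** — the learned member's certified layers (VERBATIM as in
  `exists_layers_su2Residual`), positive densities, measurable pinched running density,
  `HasJacobian Haar^⊗ F J`, under the UNIFORM refusal bound `|cf s| Σ_ν(|ρ₀| + |ρ₁|) ≤ κ₀ < 1`;
* **`su2Residual_member_fthmcN_uniformlyErgodic`** — the same member with ANY measurable bounded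
  Lipschitz increment chosen after the layers (the `nstep ≥ 2` twin of GEN-10's single-step theorem);
* **`su2Residual_member_fthmcN_exactForce_uniformlyErgodic`** — proper colouring, measurable local
  weights under the refusal bound AND smooth along smooth fields (`hρ`), ANY schedule, every `β`, `κ`,
  `κ' > 0`: the exact force is measurable and THERE IS `τ₀ > 0` such that every `n ≥ 1`, `ε' > 0` with
  `nε' ≤ τ₀` make the reported `n`-step kernel with half kick `−(ε'/2)·Φ_κ` converge to
  `wilsonMeasure SU(2).subtype β` from EVERY start, `|μ₀K̃ᵗ(A) − μ(A)| ≤ (1 − δ)^⌊t/(k+1)⌋`.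

NOT CLAIMED: any value of `τ₀`, `k`, `δ`; that a given trained network meets `hρ` / the refusal bound
(the engine's `tanh` squashing enforces the latter by construction, GEN-8); long trajectories; OMF;
floating point; any number.
-/

noncomputable section

namespace Summit.Ventures.LatticeQCDFlow.Exactness

open Set Filter Topology Function MeasureTheory ProbabilityTheory ProbabilityTheory.Kernel InnerProductGeometry
open Literature.MathematicalPhysics.QuantumFieldTheory
open Literature.MathematicalPhysics.QuantumFieldTheory.Balaban1983to89.B10Eq18SigmaSU2Haar (expPauli)
open scoped ENNReal Matrix Matrix.Norms.Operator NNReal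

set_option backward.isDefEq.respectTransparency false

section Residual

variable {d L : ℕ} {X : Type*} [DecidableEq X] (χ : Site d L → X) [NeZero L] {σ : Type*}

set_option maxHeartbeats 400000 in -- RN-23 (7)(b): heavy declaration budgeted at source (lake build ≈ 10 % hungrier than the gate)
/-- **THE LEARNED MEMBER PACKAGE** under the uniform refusal bound: certified layers VERBATIM as in
`exists_layers_su2Residual`, positive densities, measurable running density pinched in
`[((1−κ₀)^(3|E|))^#layers, ((1+κ₀)^(3|E|))^#layers]`, `HasJacobian Haar^⊗ F J`. -/
theorem su2Residual_member_package
    (hχ : ∀ (x : Site d L) (i : Fin d), χ (x.shift i) ≠ χ x) (μf : σ → Fin d) (bf : σ → X) (cf : σ → ℝ)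
    (ρf : σ → GaugeConfig d L (Matrix.specialUnitaryGroup (Fin 2) ℂ) → Edge d L → Fin d → Fin 2 → ℝ)
    (hρm : ∀ s e ν t, Measurable fun V : GaugeConfig d L (Matrix.specialUnitaryGroup (Fin 2) ℂ) => ρf s V e ν t)
    (hρloc : ∀ s (V W : GaugeConfig d L (Matrix.specialUnitaryGroup (Fin 2) ℂ)),
      (∀ j : Edge d L, ¬(j.2 = μf s ∧ χ j.1 = bf s) → V j = W j) →
        ∀ e : Edge d L, (e.2 = μf s ∧ χ e.1 = bf s) → ∀ ν t, ρf s V e ν t = ρf s W e ν t)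
    {κ₀ : ℝ} (hκ0 : 0 ≤ κ₀) (hκ₀ : κ₀ < 1)
    (hκ : ∀ s (V : GaugeConfig d L (Matrix.specialUnitaryGroup (Fin 2) ℂ)) (e : Edge d L), (e.2 = μf s ∧ χ e.1 = bf s) →
      |cf s| * ∑ ν ∈ Finset.univ.erase e.2, (|ρf s V e ν 0| + |ρf s V e ν 1|) ≤ κ₀)
    (sched : List σ) :
    ∃ layers : List ((GaugeConfig d L (Matrix.specialUnitaryGroup (Fin 2) ℂ) ≃ᵐ GaugeConfig d L (Matrix.specialUnitaryGroup (Fin 2) ℂ)) × (GaugeConfig d L (Matrix.specialUnitaryGroup (Fin 2) ℂ) → ℝ)),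
      layers.map (fun Ly => ((Ly.1 : GaugeConfig d L (Matrix.specialUnitaryGroup (Fin 2) ℂ) → GaugeConfig d L (Matrix.specialUnitaryGroup (Fin 2) ℂ)), Ly.2)) =
        sched.map (fun s =>
          ((fun (V : GaugeConfig d L (Matrix.specialUnitaryGroup (Fin 2) ℂ)) (e : Edge d L) =>
        if e.2 = μf s ∧ χ e.1 = bf s then
          gaussUnit (geodesicKick (cf s) (∑ ν ∈ Finset.univ.erase e.2,
            (ρf s V e ν 0 • vecQuat (((V (Site.shift e.1 e.2, ν) * (V (Site.shift e.1 ν, e.2))⁻¹ * (V (e.1, ν))⁻¹)⁻¹ : Matrix.specialUnitaryGroup (Fin 2) ℂ) : Matrix (Fin 2) (Fin 2) ℂ) +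
              ρf s V e ν 1 • vecQuat ((((V (Site.shift (e.1 - Pi.single ν 1) e.2, ν))⁻¹ * (V (e.1 - Pi.single ν 1, e.2))⁻¹ * V (e.1 - Pi.single ν 1, ν))⁻¹ : Matrix.specialUnitaryGroup (Fin 2) ℂ) : Matrix (Fin 2) (Fin 2) ℂ)))
            (vecQuat ((V e : Matrix.specialUnitaryGroup (Fin 2) ℂ) : Matrix (Fin 2) (Fin 2) ℂ)))
        else V e),
           fun V : GaugeConfig d L (Matrix.specialUnitaryGroup (Fin 2) ℂ) => ∏ a : {e : Edge d L // e.2 = μf s ∧ χ e.1 = bf s},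
          (if Real.sin (angle (∑ ν ∈ Finset.univ.erase a.1.2,
            (ρf s V a.1 ν 0 • vecQuat (((V (Site.shift a.1.1 a.1.2, ν) * (V (Site.shift a.1.1 ν, a.1.2))⁻¹ * (V (a.1.1, ν))⁻¹)⁻¹ : Matrix.specialUnitaryGroup (Fin 2) ℂ) : Matrix (Fin 2) (Fin 2) ℂ) +
              ρf s V a.1 ν 1 • vecQuat ((((V (Site.shift (a.1.1 - Pi.single ν 1) a.1.2, ν))⁻¹ * (V (a.1.1 - Pi.single ν 1, a.1.2))⁻¹ * V (a.1.1 - Pi.single ν 1, ν))⁻¹ : Matrix.specialUnitaryGroup (Fin 2) ℂ) : Matrix (Fin 2) (Fin 2) ℂ))) (vecQuat ((V a.1 : Matrix.specialUnitaryGroup (Fin 2) ℂ) : Matrix (Fin 2) (Fin 2) ℂ))) = 0 then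
            (1 - cf s * ‖(∑ ν ∈ Finset.univ.erase a.1.2,
            (ρf s V a.1 ν 0 • vecQuat (((V (Site.shift a.1.1 a.1.2, ν) * (V (Site.shift a.1.1 ν, a.1.2))⁻¹ * (V (a.1.1, ν))⁻¹)⁻¹ : Matrix.specialUnitaryGroup (Fin 2) ℂ) : Matrix (Fin 2) (Fin 2) ℂ) +
              ρf s V a.1 ν 1 • vecQuat ((((V (Site.shift (a.1.1 - Pi.single ν 1) a.1.2, ν))⁻¹ * (V (a.1.1 - Pi.single ν 1, a.1.2))⁻¹ * V (a.1.1 - Pi.single ν 1, ν))⁻¹ : Matrix.specialUnitaryGroup (Fin 2) ℂ) : Matrix (Fin 2) (Fin 2) ℂ)))‖ * Real.cos (angle (∑ ν ∈ Finset.univ.erase a.1.2,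
            (ρf s V a.1 ν 0 • vecQuat (((V (Site.shift a.1.1 a.1.2, ν) * (V (Site.shift a.1.1 ν, a.1.2))⁻¹ * (V (a.1.1, ν))⁻¹)⁻¹ : Matrix.specialUnitaryGroup (Fin 2) ℂ) : Matrix (Fin 2) (Fin 2) ℂ) +
              ρf s V a.1 ν 1 • vecQuat ((((V (Site.shift (a.1.1 - Pi.single ν 1) a.1.2, ν))⁻¹ * (V (a.1.1 - Pi.single ν 1, a.1.2))⁻¹ * V (a.1.1 - Pi.single ν 1, ν))⁻¹ : Matrix.specialUnitaryGroup (Fin 2) ℂ) : Matrix (Fin 2) (Fin 2) ℂ))) (vecQuat ((V a.1 : Matrix.specialUnitaryGroup (Fin 2) ℂ) : Matrix (Fin 2) (Fin 2) ℂ)))) ^ 3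
          else kickJac (cf s * ‖(∑ ν ∈ Finset.univ.erase a.1.2,
            (ρf s V a.1 ν 0 • vecQuat (((V (Site.shift a.1.1 a.1.2, ν) * (V (Site.shift a.1.1 ν, a.1.2))⁻¹ * (V (a.1.1, ν))⁻¹)⁻¹ : Matrix.specialUnitaryGroup (Fin 2) ℂ) : Matrix (Fin 2) (Fin 2) ℂ) +
              ρf s V a.1 ν 1 • vecQuat ((((V (Site.shift (a.1.1 - Pi.single ν 1) a.1.2, ν))⁻¹ * (V (a.1.1 - Pi.single ν 1, a.1.2))⁻¹ * V (a.1.1 - Pi.single ν 1, ν))⁻¹ : Matrix.specialUnitaryGroup (Fin 2) ℂ) : Matrix (Fin 2) (Fin 2) ℂ)))‖) 2 (angle (∑ ν ∈ Finset.univ.erase a.1.2,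
            (ρf s V a.1 ν 0 • vecQuat (((V (Site.shift a.1.1 a.1.2, ν) * (V (Site.shift a.1.1 ν, a.1.2))⁻¹ * (V (a.1.1, ν))⁻¹)⁻¹ : Matrix.specialUnitaryGroup (Fin 2) ℂ) : Matrix (Fin 2) (Fin 2) ℂ) +
              ρf s V a.1 ν 1 • vecQuat ((((V (Site.shift (a.1.1 - Pi.single ν 1) a.1.2, ν))⁻¹ * (V (a.1.1 - Pi.single ν 1, a.1.2))⁻¹ * V (a.1.1 - Pi.single ν 1, ν))⁻¹ : Matrix.specialUnitaryGroup (Fin 2) ℂ) : Matrix (Fin 2) (Fin 2) ℂ))) (vecQuat ((V a.1 : Matrix.specialUnitaryGroup (Fin 2) ℂ) : Matrix (Fin 2) (Fin 2) ℂ)))))) ∧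
      (∀ Ly ∈ layers, ∀ V, 0 < Ly.2 V) ∧
      Measurable (layers.foldr (fun Ly K => fun v => Ly.2 v * K (Ly.1 v)) (fun _ => (1 : ℝ))) ∧
      HasJacobian (Measure.pi fun _ : Edge d L => haarProbability (Matrix.specialUnitaryGroup (Fin 2) ℂ)) ⇑(layers.foldr (fun Ly (F : GaugeConfig d L (Matrix.specialUnitaryGroup (Fin 2) ℂ) ≃ᵐ GaugeConfig d L (Matrix.specialUnitaryGroup (Fin 2) ℂ)) => Ly.1.trans F) (MeasurableEquiv.refl (GaugeConfig d L (Matrix.specialUnitaryGroup (Fin 2) ℂ)))) (fun v => ENNReal.ofReal ((layers.foldr (fun Ly K => fun v => Ly.2 v * K (Ly.1 v)) (fun _ => (1 : ℝ))) v)) ∧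
      ∀ v, (layers.foldr (fun Ly K => fun v => Ly.2 v * K (Ly.1 v)) (fun _ => (1 : ℝ))) v ∈
        Icc (((1 - κ₀) ^ (3 * Fintype.card (Edge d L))) ^ layers.length) (((1 + κ₀) ^ (3 * Fintype.card (Edge d L))) ^ layers.length) := by
  have h := su2MaskedKickSchedule_package (fun (s : σ) (e : Edge d L) => e.2 = μf s ∧ χ e.1 = bf s)
    cf (fun s => (fun (V : GaugeConfig d L (Matrix.specialUnitaryGroup (Fin 2) ℂ)) (e : Edge d L) => ∑ ν ∈ Finset.univ.erase e.2,
        (ρf s V e ν 0 • vecQuat (((V (Site.shift e.1 e.2, ν) * (V (Site.shift e.1 ν, e.2))⁻¹ * (V (e.1, ν))⁻¹)⁻¹ : Matrix.specialUnitaryGroup (Fin 2) ℂ) : Matrix (Fin 2) (Fin 2) ℂ) +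
          ρf s V e ν 1 • vecQuat ((((V (Site.shift (e.1 - Pi.single ν 1) e.2, ν))⁻¹ * (V (e.1 - Pi.single ν 1, e.2))⁻¹ * V (e.1 - Pi.single ν 1, ν))⁻¹ : Matrix.specialUnitaryGroup (Fin 2) ℂ) : Matrix (Fin 2) (Fin 2) ℂ))))
    (fun s e _ => measurable_residualJ (ρf s) e (hρm s e))
    (fun s V W hVW e he => residualJ_local χ hχ (ρf s) he hVW (hρloc s V W hVW e he))
    hκ0 hκ₀
    (fun s V e he => (mul_le_mul_of_nonneg_left (norm_residualJ_le (ρf s) V e) (abs_nonneg (cf s))).trans (hκ s V e he))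
    sched
  beta_reduce at h
  exact h

set_option maxHeartbeats 400000 in -- RN-23 (7)(b): heavy declaration budgeted at source (lake build ≈ 10 % hungrier than the gate)
/-- **MULTI-STEP FT-HMC THROUGH A LEARNED RESIDUAL MEMBER WITH ANY INCREMENT is uniformly ergodic for
short trajectories** (the `nstep ≥ 2` twin of GEN-10's `su2Residual_member_fthmc_uniformlyErgodic`; the
increment `g`, the action `S` and the trajectory parameters are chosen AFTER the layers). -/
theorem su2Residual_member_fthmcN_uniformlyErgodic
    (hχ : ∀ (x : Site d L) (i : Fin d), χ (x.shift i) ≠ χ x) (μf : σ → Fin d) (bf : σ → X) (cf : σ → ℝ)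
    (ρf : σ → GaugeConfig d L (Matrix.specialUnitaryGroup (Fin 2) ℂ) → Edge d L → Fin d → Fin 2 → ℝ)
    (hρm : ∀ s e ν t, Measurable fun V : GaugeConfig d L (Matrix.specialUnitaryGroup (Fin 2) ℂ) => ρf s V e ν t)
    (hρloc : ∀ s (V W : GaugeConfig d L (Matrix.specialUnitaryGroup (Fin 2) ℂ)),
      (∀ j : Edge d L, ¬(j.2 = μf s ∧ χ j.1 = bf s) → V j = W j) →
        ∀ e : Edge d L, (e.2 = μf s ∧ χ e.1 = bf s) → ∀ ν t, ρf s V e ν t = ρf s W e ν t)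
    {κ₀ : ℝ} (hκ0 : 0 ≤ κ₀) (hκ₀ : κ₀ < 1)
    (hκ : ∀ s (V : GaugeConfig d L (Matrix.specialUnitaryGroup (Fin 2) ℂ)) (e : Edge d L), (e.2 = μf s ∧ χ e.1 = bf s) →
      |cf s| * ∑ ν ∈ Finset.univ.erase e.2, (|ρf s V e ν 0| + |ρf s V e ν 1|) ≤ κ₀)
    (sched : List σ) :
    ∃ layers : List ((GaugeConfig d L (Matrix.specialUnitaryGroup (Fin 2) ℂ) ≃ᵐ GaugeConfig d L (Matrix.specialUnitaryGroup (Fin 2) ℂ)) × (GaugeConfig d L (Matrix.specialUnitaryGroup (Fin 2) ℂ) → ℝ)),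
      layers.map (fun Ly => ((Ly.1 : GaugeConfig d L (Matrix.specialUnitaryGroup (Fin 2) ℂ) → GaugeConfig d L (Matrix.specialUnitaryGroup (Fin 2) ℂ)), Ly.2)) =
        sched.map (fun s =>
          ((fun (V : GaugeConfig d L (Matrix.specialUnitaryGroup (Fin 2) ℂ)) (e : Edge d L) =>
        if e.2 = μf s ∧ χ e.1 = bf s then
          gaussUnit (geodesicKick (cf s) (∑ ν ∈ Finset.univ.erase e.2,
            (ρf s V e ν 0 • vecQuat (((V (Site.shift e.1 e.2, ν) * (V (Site.shift e.1 ν, e.2))⁻¹ * (V (e.1, ν))⁻¹)⁻¹ : Matrix.specialUnitaryGroup (Fin 2) ℂ) : Matrix (Fin 2) (Fin 2) ℂ) +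
              ρf s V e ν 1 • vecQuat ((((V (Site.shift (e.1 - Pi.single ν 1) e.2, ν))⁻¹ * (V (e.1 - Pi.single ν 1, e.2))⁻¹ * V (e.1 - Pi.single ν 1, ν))⁻¹ : Matrix.specialUnitaryGroup (Fin 2) ℂ) : Matrix (Fin 2) (Fin 2) ℂ)))
            (vecQuat ((V e : Matrix.specialUnitaryGroup (Fin 2) ℂ) : Matrix (Fin 2) (Fin 2) ℂ)))
        else V e),
           fun V : GaugeConfig d L (Matrix.specialUnitaryGroup (Fin 2) ℂ) => ∏ a : {e : Edge d L // e.2 = μf s ∧ χ e.1 = bf s},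
          (if Real.sin (angle (∑ ν ∈ Finset.univ.erase a.1.2,
            (ρf s V a.1 ν 0 • vecQuat (((V (Site.shift a.1.1 a.1.2, ν) * (V (Site.shift a.1.1 ν, a.1.2))⁻¹ * (V (a.1.1, ν))⁻¹)⁻¹ : Matrix.specialUnitaryGroup (Fin 2) ℂ) : Matrix (Fin 2) (Fin 2) ℂ) +
              ρf s V a.1 ν 1 • vecQuat ((((V (Site.shift (a.1.1 - Pi.single ν 1) a.1.2, ν))⁻¹ * (V (a.1.1 - Pi.single ν 1, a.1.2))⁻¹ * V (a.1.1 - Pi.single ν 1, ν))⁻¹ : Matrix.specialUnitaryGroup (Fin 2) ℂ) : Matrix (Fin 2) (Fin 2) ℂ))) (vecQuat ((V a.1 : Matrix.specialUnitaryGroup (Fin 2) ℂ) : Matrix (Fin 2) (Fin 2) ℂ))) = 0 then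
            (1 - cf s * ‖(∑ ν ∈ Finset.univ.erase a.1.2,
            (ρf s V a.1 ν 0 • vecQuat (((V (Site.shift a.1.1 a.1.2, ν) * (V (Site.shift a.1.1 ν, a.1.2))⁻¹ * (V (a.1.1, ν))⁻¹)⁻¹ : Matrix.specialUnitaryGroup (Fin 2) ℂ) : Matrix (Fin 2) (Fin 2) ℂ) +
              ρf s V a.1 ν 1 • vecQuat ((((V (Site.shift (a.1.1 - Pi.single ν 1) a.1.2, ν))⁻¹ * (V (a.1.1 - Pi.single ν 1, a.1.2))⁻¹ * V (a.1.1 - Pi.single ν 1, ν))⁻¹ : Matrix.specialUnitaryGroup (Fin 2) ℂ) : Matrix (Fin 2) (Fin 2) ℂ)))‖ * Real.cos (angle (∑ ν ∈ Finset.univ.erase a.1.2,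
            (ρf s V a.1 ν 0 • vecQuat (((V (Site.shift a.1.1 a.1.2, ν) * (V (Site.shift a.1.1 ν, a.1.2))⁻¹ * (V (a.1.1, ν))⁻¹)⁻¹ : Matrix.specialUnitaryGroup (Fin 2) ℂ) : Matrix (Fin 2) (Fin 2) ℂ) +
              ρf s V a.1 ν 1 • vecQuat ((((V (Site.shift (a.1.1 - Pi.single ν 1) a.1.2, ν))⁻¹ * (V (a.1.1 - Pi.single ν 1, a.1.2))⁻¹ * V (a.1.1 - Pi.single ν 1, ν))⁻¹ : Matrix.specialUnitaryGroup (Fin 2) ℂ) : Matrix (Fin 2) (Fin 2) ℂ))) (vecQuat ((V a.1 : Matrix.specialUnitaryGroup (Fin 2) ℂ) : Matrix (Fin 2) (Fin 2) ℂ)))) ^ 3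
          else kickJac (cf s * ‖(∑ ν ∈ Finset.univ.erase a.1.2,
            (ρf s V a.1 ν 0 • vecQuat (((V (Site.shift a.1.1 a.1.2, ν) * (V (Site.shift a.1.1 ν, a.1.2))⁻¹ * (V (a.1.1, ν))⁻¹)⁻¹ : Matrix.specialUnitaryGroup (Fin 2) ℂ) : Matrix (Fin 2) (Fin 2) ℂ) +
              ρf s V a.1 ν 1 • vecQuat ((((V (Site.shift (a.1.1 - Pi.single ν 1) a.1.2, ν))⁻¹ * (V (a.1.1 - Pi.single ν 1, a.1.2))⁻¹ * V (a.1.1 - Pi.single ν 1, ν))⁻¹ : Matrix.specialUnitaryGroup (Fin 2) ℂ) : Matrix (Fin 2) (Fin 2) ℂ)))‖) 2 (angle (∑ ν ∈ Finset.univ.erase a.1.2,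
            (ρf s V a.1 ν 0 • vecQuat (((V (Site.shift a.1.1 a.1.2, ν) * (V (Site.shift a.1.1 ν, a.1.2))⁻¹ * (V (a.1.1, ν))⁻¹)⁻¹ : Matrix.specialUnitaryGroup (Fin 2) ℂ) : Matrix (Fin 2) (Fin 2) ℂ) +
              ρf s V a.1 ν 1 • vecQuat ((((V (Site.shift (a.1.1 - Pi.single ν 1) a.1.2, ν))⁻¹ * (V (a.1.1 - Pi.single ν 1, a.1.2))⁻¹ * V (a.1.1 - Pi.single ν 1, ν))⁻¹ : Matrix.specialUnitaryGroup (Fin 2) ℂ) : Matrix (Fin 2) (Fin 2) ℂ))) (vecQuat ((V a.1 : Matrix.specialUnitaryGroup (Fin 2) ℂ) : Matrix (Fin 2) (Fin 2) ℂ)))))) ∧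
      ∀ {ε' κ' : ℝ} (_hε' : 0 < ε') (_hκ' : 0 < κ') {n : ℕ} (_hn : 1 ≤ n)
        {g : GaugeConfig d L (Matrix.specialUnitaryGroup (Fin 2) ℂ) → Edge d L → EuclideanSpace ℝ (Fin 3)} (hg : Measurable g) {b' : ℝ} (_hb0 : 0 ≤ b')
        (_hb : ∀ u l, ‖g u l‖ ≤ b') {Kg : ℝ} (_hK0 : 0 ≤ Kg)
        (_hK : ∀ U U', ‖g U - g U'‖ ≤ Kg * ‖coeConfig U - coeConfig U'‖)
        {S : GaugeConfig d L (Matrix.specialUnitaryGroup (Fin 2) ℂ) → ℝ} (_hS : Measurable S) {s' : ℝ} (_hs : ∀ u, |S u| ≤ s')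
        (_h1 : n * ε' ≤ sunShortTrajThreshold pauliCoordι pauliCoordι_injective)
        (_h2 : (2 * n + 1) * b' ≤ sunShortTrajThreshold pauliCoordι pauliCoordι_injective)
        (_h3 : Kg * ε' * (n : ℝ) ^ 2 ≤ sunShortTrajThreshold pauliCoordι pauliCoordι_injective),
        ∃ k : ℕ, ∃ δ : ℝ, 0 < δ ∧ δ ≤ 1 ∧ ∀ (μ₀ : Measure (GaugeConfig d L (Matrix.specialUnitaryGroup (Fin 2) ℂ))) [IsProbabilityMeasure μ₀] (t : ℕ) (A : Set (GaugeConfig d L (Matrix.specialUnitaryGroup (Fin 2) ℂ))),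
          |((fun m : Measure (GaugeConfig d L (Matrix.specialUnitaryGroup (Fin 2) ℂ)) =>
                m.bind (conjKernel (su2LeapfrogHMCN ε' κ' hg (fun V => S ((layers.foldr (fun Ly (F : GaugeConfig d L (Matrix.specialUnitaryGroup (Fin 2) ℂ) ≃ᵐ GaugeConfig d L (Matrix.specialUnitaryGroup (Fin 2) ℂ)) => Ly.1.trans F) (MeasurableEquiv.refl (GaugeConfig d L (Matrix.specialUnitaryGroup (Fin 2) ℂ)))) V) - Real.log ((layers.foldr (fun Ly K => fun v => Ly.2 v * K (Ly.1 v)) (fun _ => (1 : ℝ))) V)) n) (layers.foldr (fun Ly (F : GaugeConfig d L (Matrix.specialUnitaryGroup (Fin 2) ℂ) ≃ᵐ GaugeConfig d L (Matrix.specialUnitaryGroup (Fin 2) ℂ)) => Ly.1.trans F) (MeasurableEquiv.refl (GaugeConfig d L (Matrix.specialUnitaryGroup (Fin 2) ℂ))))))^[t] μ₀).real A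
              - (su2GibbsLaw S).real A| ≤ (1 - δ) ^ (t / (k + 1)) := by
  obtain ⟨layers, hmap, hpos, hfmeas, hfjac, hfold⟩ :=
    su2Residual_member_package χ hχ μf bf cf ρf hρm hρloc hκ0 hκ₀ hκ sched
  refine ⟨layers, hmap, ?_⟩
  intro ε' κ' hε' hκ' n hn g hg b' hb0 hb Kg hK0 hK S hS s' hs h1 h2 h3
  exact su2LeapfrogFTHMCN_uniformlyErgodic hε' hκ' hn hg hb0 hb hK0 hK hS hs
    (pow_pos (pow_pos (by linarith) _) _) (fun v => (hfold v).1) (fun v => (hfold v).2) hfmeas hfjac h1 h2 h3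

set_option maxHeartbeats 400000 in -- RN-23 (7)(b): heavy declaration budgeted at source (lake build ≈ 10 % hungrier than the gate)
/-- **MULTI-STEP FT-HMC THROUGH A LEARNED RESIDUAL `SU(2)` MEMBER WITH THE EXACT FORCE AS RUN CONVERGES TO
THE WILSON MEASURE FROM EVERY START, BELOW A TRAJECTORY-LENGTH THRESHOLD** (proper colouring, measurable
local weights under the refusal bound, smooth along smooth fields; ANY schedule; every `β`, `κ`,
`κ' > 0`). -/
theorem su2Residual_member_fthmcN_exactForce_uniformlyErgodic
    (hχ : ∀ (x : Site d L) (i : Fin d), χ (x.shift i) ≠ χ x) (μf : σ → Fin d) (bf : σ → X) (cf : σ → ℝ)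
    (ρf : σ → GaugeConfig d L (Matrix.specialUnitaryGroup (Fin 2) ℂ) → Edge d L → Fin d → Fin 2 → ℝ)
    (hρm : ∀ s e ν t, Measurable fun V : GaugeConfig d L (Matrix.specialUnitaryGroup (Fin 2) ℂ) => ρf s V e ν t)
    (hρloc : ∀ s (V W : GaugeConfig d L (Matrix.specialUnitaryGroup (Fin 2) ℂ)),
      (∀ j : Edge d L, ¬(j.2 = μf s ∧ χ j.1 = bf s) → V j = W j) →
        ∀ e : Edge d L, (e.2 = μf s ∧ χ e.1 = bf s) → ∀ ν t, ρf s V e ν t = ρf s W e ν t)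
    {κ₀ : ℝ} (hκ0 : 0 ≤ κ₀) (hκ₀ : κ₀ < 1)
    (hκ : ∀ s (V : GaugeConfig d L (Matrix.specialUnitaryGroup (Fin 2) ℂ)) (e : Edge d L), (e.2 = μf s ∧ χ e.1 = bf s) →
      |cf s| * ∑ ν ∈ Finset.univ.erase e.2, (|ρf s V e ν 0| + |ρf s V e ν 1|) ≤ κ₀)
    (hρ : ∀ {n : WithTop ℕ∞} (s : σ) (U : (Edge d L → Matrix (Fin 2) (Fin 2) ℂ) × (Edge d L → EuclideanSpace ℝ (Fin 3)) → GaugeConfig d L (Matrix.specialUnitaryGroup (Fin 2) ℂ)) (p₀ : (Edge d L → Matrix (Fin 2) (Fin 2) ℂ) × (Edge d L → EuclideanSpace ℝ (Fin 3))), (∀ e : Edge d L, ContDiffAt ℝ n (fun p : (Edge d L → Matrix (Fin 2) (Fin 2) ℂ) × (Edge d L → EuclideanSpace ℝ (Fin 3)) => ((U p e : (Matrix.specialUnitaryGroup (Fin 2) ℂ)) : Matrix (Fin 2) (Fin 2) ℂ)) p₀) →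
      ∀ (e : Edge d L) (ν : Fin d) (b : Fin 2), ContDiffAt ℝ n (fun p : (Edge d L → Matrix (Fin 2) (Fin 2) ℂ) × (Edge d L → EuclideanSpace ℝ (Fin 3)) => ρf s (U p) e ν b) p₀)
    (sched : List σ) (β κ : ℝ) {κ' : ℝ} (hκ' : 0 < κ') :
    ∃ layers : List ((GaugeConfig d L (Matrix.specialUnitaryGroup (Fin 2) ℂ) ≃ᵐ GaugeConfig d L (Matrix.specialUnitaryGroup (Fin 2) ℂ)) × (GaugeConfig d L (Matrix.specialUnitaryGroup (Fin 2) ℂ) → ℝ)),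
      layers.map (fun Ly => ((Ly.1 : GaugeConfig d L (Matrix.specialUnitaryGroup (Fin 2) ℂ) → GaugeConfig d L (Matrix.specialUnitaryGroup (Fin 2) ℂ)), Ly.2)) =
        sched.map (fun s =>
          ((fun (V : GaugeConfig d L (Matrix.specialUnitaryGroup (Fin 2) ℂ)) (e : Edge d L) =>
        if e.2 = μf s ∧ χ e.1 = bf s then
          gaussUnit (geodesicKick (cf s) (∑ ν ∈ Finset.univ.erase e.2,
            (ρf s V e ν 0 • vecQuat (((V (Site.shift e.1 e.2, ν) * (V (Site.shift e.1 ν, e.2))⁻¹ * (V (e.1, ν))⁻¹)⁻¹ : Matrix.specialUnitaryGroup (Fin 2) ℂ) : Matrix (Fin 2) (Fin 2) ℂ) +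
              ρf s V e ν 1 • vecQuat ((((V (Site.shift (e.1 - Pi.single ν 1) e.2, ν))⁻¹ * (V (e.1 - Pi.single ν 1, e.2))⁻¹ * V (e.1 - Pi.single ν 1, ν))⁻¹ : Matrix.specialUnitaryGroup (Fin 2) ℂ) : Matrix (Fin 2) (Fin 2) ℂ)))
            (vecQuat ((V e : Matrix.specialUnitaryGroup (Fin 2) ℂ) : Matrix (Fin 2) (Fin 2) ℂ)))
        else V e),
           fun V : GaugeConfig d L (Matrix.specialUnitaryGroup (Fin 2) ℂ) => ∏ a : {e : Edge d L // e.2 = μf s ∧ χ e.1 = bf s},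
          (if Real.sin (angle (∑ ν ∈ Finset.univ.erase a.1.2,
            (ρf s V a.1 ν 0 • vecQuat (((V (Site.shift a.1.1 a.1.2, ν) * (V (Site.shift a.1.1 ν, a.1.2))⁻¹ * (V (a.1.1, ν))⁻¹)⁻¹ : Matrix.specialUnitaryGroup (Fin 2) ℂ) : Matrix (Fin 2) (Fin 2) ℂ) +
              ρf s V a.1 ν 1 • vecQuat ((((V (Site.shift (a.1.1 - Pi.single ν 1) a.1.2, ν))⁻¹ * (V (a.1.1 - Pi.single ν 1, a.1.2))⁻¹ * V (a.1.1 - Pi.single ν 1, ν))⁻¹ : Matrix.specialUnitaryGroup (Fin 2) ℂ) : Matrix (Fin 2) (Fin 2) ℂ))) (vecQuat ((V a.1 : Matrix.specialUnitaryGroup (Fin 2) ℂ) : Matrix (Fin 2) (Fin 2) ℂ))) = 0 then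
            (1 - cf s * ‖(∑ ν ∈ Finset.univ.erase a.1.2,
            (ρf s V a.1 ν 0 • vecQuat (((V (Site.shift a.1.1 a.1.2, ν) * (V (Site.shift a.1.1 ν, a.1.2))⁻¹ * (V (a.1.1, ν))⁻¹)⁻¹ : Matrix.specialUnitaryGroup (Fin 2) ℂ) : Matrix (Fin 2) (Fin 2) ℂ) +
              ρf s V a.1 ν 1 • vecQuat ((((V (Site.shift (a.1.1 - Pi.single ν 1) a.1.2, ν))⁻¹ * (V (a.1.1 - Pi.single ν 1, a.1.2))⁻¹ * V (a.1.1 - Pi.single ν 1, ν))⁻¹ : Matrix.specialUnitaryGroup (Fin 2) ℂ) : Matrix (Fin 2) (Fin 2) ℂ)))‖ * Real.cos (angle (∑ ν ∈ Finset.univ.erase a.1.2,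
            (ρf s V a.1 ν 0 • vecQuat (((V (Site.shift a.1.1 a.1.2, ν) * (V (Site.shift a.1.1 ν, a.1.2))⁻¹ * (V (a.1.1, ν))⁻¹)⁻¹ : Matrix.specialUnitaryGroup (Fin 2) ℂ) : Matrix (Fin 2) (Fin 2) ℂ) +
              ρf s V a.1 ν 1 • vecQuat ((((V (Site.shift (a.1.1 - Pi.single ν 1) a.1.2, ν))⁻¹ * (V (a.1.1 - Pi.single ν 1, a.1.2))⁻¹ * V (a.1.1 - Pi.single ν 1, ν))⁻¹ : Matrix.specialUnitaryGroup (Fin 2) ℂ) : Matrix (Fin 2) (Fin 2) ℂ))) (vecQuat ((V a.1 : Matrix.specialUnitaryGroup (Fin 2) ℂ) : Matrix (Fin 2) (Fin 2) ℂ)))) ^ 3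
          else kickJac (cf s * ‖(∑ ν ∈ Finset.univ.erase a.1.2,
            (ρf s V a.1 ν 0 • vecQuat (((V (Site.shift a.1.1 a.1.2, ν) * (V (Site.shift a.1.1 ν, a.1.2))⁻¹ * (V (a.1.1, ν))⁻¹)⁻¹ : Matrix.specialUnitaryGroup (Fin 2) ℂ) : Matrix (Fin 2) (Fin 2) ℂ) +
              ρf s V a.1 ν 1 • vecQuat ((((V (Site.shift (a.1.1 - Pi.single ν 1) a.1.2, ν))⁻¹ * (V (a.1.1 - Pi.single ν 1, a.1.2))⁻¹ * V (a.1.1 - Pi.single ν 1, ν))⁻¹ : Matrix.specialUnitaryGroup (Fin 2) ℂ) : Matrix (Fin 2) (Fin 2) ℂ)))‖) 2 (angle (∑ ν ∈ Finset.univ.erase a.1.2,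
            (ρf s V a.1 ν 0 • vecQuat (((V (Site.shift a.1.1 a.1.2, ν) * (V (Site.shift a.1.1 ν, a.1.2))⁻¹ * (V (a.1.1, ν))⁻¹)⁻¹ : Matrix.specialUnitaryGroup (Fin 2) ℂ) : Matrix (Fin 2) (Fin 2) ℂ) +
              ρf s V a.1 ν 1 • vecQuat ((((V (Site.shift (a.1.1 - Pi.single ν 1) a.1.2, ν))⁻¹ * (V (a.1.1 - Pi.single ν 1, a.1.2))⁻¹ * V (a.1.1 - Pi.single ν 1, ν))⁻¹ : Matrix.specialUnitaryGroup (Fin 2) ℂ) : Matrix (Fin 2) (Fin 2) ℂ))) (vecQuat ((V a.1 : Matrix.specialUnitaryGroup (Fin 2) ℂ) : Matrix (Fin 2) (Fin 2) ℂ)))))) ∧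
      ∃ hΦ : Measurable (fun (V : GaugeConfig d L (Matrix.specialUnitaryGroup (Fin 2) ℂ)) (l : Edge d L) => κ • WithLp.toLp 2 (fun i : Fin 3 =>
        fderiv ℝ (fun a : Edge d L → EuclideanSpace ℝ (Fin 3) => β * wilsonAction (Matrix.specialUnitaryGroup (Fin 2) ℂ).subtype ((layers.foldr (fun Ly (F : GaugeConfig d L (Matrix.specialUnitaryGroup (Fin 2) ℂ) ≃ᵐ GaugeConfig d L (Matrix.specialUnitaryGroup (Fin 2) ℂ)) => Ly.1.trans F) (MeasurableEquiv.refl (GaugeConfig d L (Matrix.specialUnitaryGroup (Fin 2) ℂ)))) ((fun l : Edge d L => expPauli (a l)) * V)) - Real.log ((layers.foldr (fun Ly K => fun v => Ly.2 v * K (Ly.1 v)) (fun _ => (1 : ℝ))) ((fun l : Edge d L => expPauli (a l)) * V))) 0 (Pi.single l (EuclideanSpace.single i (1 : ℝ))))),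
      ∃ τ₀ : ℝ, 0 < τ₀ ∧ ∀ (n : ℕ) (ε' : ℝ) (_hn : 1 ≤ n) (_hε' : 0 < ε'), n * ε' ≤ τ₀ →
        ∃ k : ℕ, ∃ δ : ℝ, 0 < δ ∧ δ ≤ 1 ∧ ∀ (μ₀ : Measure (GaugeConfig d L (Matrix.specialUnitaryGroup (Fin 2) ℂ))) [IsProbabilityMeasure μ₀] (t : ℕ) (A : Set (GaugeConfig d L (Matrix.specialUnitaryGroup (Fin 2) ℂ))),
          |((fun m : Measure (GaugeConfig d L (Matrix.specialUnitaryGroup (Fin 2) ℂ)) =>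
                m.bind (conjKernel (su2LeapfrogHMCN ε' κ' (measurable_halfKick_su2 hΦ ε')
                  (fun V : GaugeConfig d L (Matrix.specialUnitaryGroup (Fin 2) ℂ) => β * wilsonAction (Matrix.specialUnitaryGroup (Fin 2) ℂ).subtype ((layers.foldr (fun Ly (F : GaugeConfig d L (Matrix.specialUnitaryGroup (Fin 2) ℂ) ≃ᵐ GaugeConfig d L (Matrix.specialUnitaryGroup (Fin 2) ℂ)) => Ly.1.trans F) (MeasurableEquiv.refl (GaugeConfig d L (Matrix.specialUnitaryGroup (Fin 2) ℂ)))) V) - Real.log ((layers.foldr (fun Ly K => fun v => Ly.2 v * K (Ly.1 v)) (fun _ => (1 : ℝ))) V)) n) (layers.foldr (fun Ly (F : GaugeConfig d L (Matrix.specialUnitaryGroup (Fin 2) ℂ) ≃ᵐ GaugeConfig d L (Matrix.specialUnitaryGroup (Fin 2) ℂ)) => Ly.1.trans F) (MeasurableEquiv.refl (GaugeConfig d L (Matrix.specialUnitaryGroup (Fin 2) ℂ))))))^[t] μ₀).real A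
            - (wilsonMeasure (Matrix.specialUnitaryGroup (Fin 2) ℂ).subtype β).real A| ≤ (1 - δ) ^ (t / (k + 1)) := by
  obtain ⟨layers, hmap, hpos, hfmeas, hfjac, hfold⟩ :=
    su2Residual_member_package χ hχ μf bf cf ρf hρm hρloc hκ0 hκ₀ hκ sched
  refine ⟨layers, hmap, ?_⟩
  obtain ⟨hΦm, Φmax, KΦ, hΦ0, hK0, hb, hK⟩ :=
    su2Residual_exactForce_regular χ μf bf cf ρf hρ sched layers hmap hpos β κ
  refine ⟨hΦm, ?_⟩
  have hρc : Continuous ⇑((Matrix.specialUnitaryGroup (Fin 2) ℂ).subtype) := continuous_subtype_val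
  have hSc : Continuous fun U : GaugeConfig d L (Matrix.specialUnitaryGroup (Fin 2) ℂ) => β * wilsonAction (Matrix.specialUnitaryGroup (Fin 2) ℂ).subtype U :=
    continuous_smul_wilsonAction _ hρc β
  obtain ⟨s, hs⟩ := exists_bound_smul_wilsonAction (d := d) (L := L) (Matrix.specialUnitaryGroup (Fin 2) ℂ).subtype hρc β
  obtain ⟨τ₀, hτ₀, hconv⟩ := su2LeapfrogFTHMCN_uniformlyErgodic_of_trajLength
    (S := fun U : GaugeConfig d L (Matrix.specialUnitaryGroup (Fin 2) ℂ) => β * wilsonAction (Matrix.specialUnitaryGroup (Fin 2) ℂ).subtype U) hκ' hΦm hΦ0 hb hK0 hK hSc.measurable hs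
    (pow_pos (pow_pos (by linarith) _) _) (fun v => (hfold v).1) (fun v => (hfold v).2) hfmeas hfjac
  refine ⟨τ₀, hτ₀, fun n ε' hn hε' hτ => ?_⟩
  obtain ⟨k, δ, hδ0, hδ1, hbound⟩ := hconv n ε' hn hε' hτ
  refine ⟨k, δ, hδ0, hδ1, fun μ₀ _ t A => ?_⟩
  rw [← su2GibbsLaw_eq_wilsonMeasure (d := d) (L := L) (Matrix.specialUnitaryGroup (Fin 2) ℂ).subtype β]
  exact hbound μ₀ t A

end Residual

end Summit.Ventures.LatticeQCDFlow.Exactness
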